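import Summits.BirchSwinnertonDyer.BirchSwinnertonDyer.Theorems.KimAtThreeShallowEqDeepAnomalousFineKato
import HarnessLib

/-!
# Route `KimAtThreeKolyvagin` (W2): the ROW CONCLUSIONS of 19599 / 19077 (shallow = deep), the LEAF
# `N11.KimAtThreeRankZeroPUB` and 19679 / 19075 (lower) on the good ANOMALOUS `t = 0` tower rows, FROM
# PUB + the fine Kato package (C1_τ) ALONE

Cell `bsd-addord`, seat `bsd-addord-w2-c4` (gen 9; owner of crux 19599 `ShallowEqDeepOffKatoStratum`, item
19077 `ShallowEqDeepAtTorsionFree`).  `--supports` 19077.  HONEST FRAMING: END THEOREMS WITH DISPLAYED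
HYPOTHESES (no definition, no named fact, no instance, no `sorry`); the published inputs ([S24] Thm 4.4 (1)(2),
GZK, Poitou–Tate) and (C1_τ) are DISPLAYED; nothing booked; 19560 / 19599 / 19077 / 19679 stay OPEN; BSD is not
proved by any of this.  Credit: the seat's gen-8 rows (`KimAtThreeShallowEqDeepPortNonAddFineKato` §3–§5,
p487145/p487420) VERBATIM with (C1′) ↦ (C1_τ) and the non-anomaly certificate ↦ `3 ∤ N`; gen 7's PortRows
(`shallowEqDeep_row_of_portUnlocked`, `leaf_row_of_portUnlocked`, `lower_row_of_portUnlocked`) on the companion's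
`portTwoExp_zero_of_fineKatoτ_of_good`.  See the companion's module docstring for (C1_τ) and its STATUS (the
lattice lemma).  READING (08-28 residual): on the GOOD `t = 0` tower rows of W2 — anomalous INCLUDED — shallow =
deep (19599 / 19077), the LEAF row and the lower row (19679 / 19075) follow from PUB + ONE displayed construction
object (C1_τ) = 19560's debt class (C1) read through the Euler-factor lattice; no `Addv`, no `3 ∤ c₃`, no Manin,
no period transfer, no auxiliary datum, no non-anomaly hypothesis displayed.

References: [Kim2025RefinedTNC] Thm 1.1/1.2; [Kim2022StructureSelmer] Thm. 1.9 (6), Lemma 3.4, Thm. 3.13;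
[Sakamoto2024] Thm. 4.4; [MazurRubin2004] Thm. 4.4.1, 5.2.12, App. A; [Kato2004Asterisque] Thm. 9.7, Ex. 13.3.
-/

set_option autoImplicit false
-- the Theorems namespace of a single-conjunct summit repeats the summit name by design (D-0017)
set_option linter.dupNamespace false

noncomputable section

open scoped NumberField TensorProduct ContRepresentation Classical
open CategoryTheory Field Function Finset IsDedekindDomain NumberField WeierstrassCurve
open Rat.HeightOneSpectrum
open Literature.NumberTheory.GaloisRepresentations Literature.NumberTheory.GaloisCohomology
open Literature.NumberTheory.GaloisRepresentations.DiscreteGaloisModule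
open Literature.NumberTheory.EllipticCurves Literature.NumberTheory.EllipticCurves.ModularForms
open Literature.NumberTheory.EllipticCurves.Kato2004
open Literature.NumberTheory.EllipticCurves.Kato2004.EulerSystemValues

namespace Summit.BirchSwinnertonDyer.BirchSwinnertonDyer.Theorems.KimAtThreeShallowEqDeepAnomalousRows

open Summit.BirchSwinnertonDyer.Rank1Residual.GaloisImage
open Summit.BirchSwinnertonDyer.BirchSwinnertonDyer.Theorems
open Summit.BirchSwinnertonDyer.BirchSwinnertonDyer.Theorems.KimAtThreeShallowEqDeepAnomalousFineKato

section Rows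

variable (W : WeierstrassCurve ℚ) [W.IsElliptic] [W.IsGloballyMinimal]

/-- **SHALLOW = DEEP — the conclusion of cruxes 19599 `ShallowEqDeepOffKatoStratum` / 19077
`ShallowEqDeepAtTorsionFree` — AT a good (ANOMALOUS allowed) `t = 0` TOWER ROW with the datum at the
conductor, FROM PUB + (C1_τ) ALONE**: `∂^{(∞)}_deep(δ̃) ≤ ∂^{(∞)}(δ̃)` for `D.f`, from [S24] Thm 4.4 (1)(2),
GZK, Poitou–Tate (by name), the `3`-adic tower, `#E(ℚ₃)[3] = 1`, `3`-integral plus symbols, `ord(δ̃) = 0`, a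
place `v₃ ∣ 3`, one generator family `η`, `3 ∤ N` and (C1_τ) for `D.f`.  Gen 7's
`KimAtThreeShallowEqDeepPortRows.shallowEqDeep_row_of_portUnlocked` on §2.  No `Addv`, no `3 ∤ c₃`, no `9 ∣ N`,
no Manin constant, no period transfer, no `hbad`, no auxiliary datum, NO non-anomaly hypothesis displayed.  Nothing booked.
[cite: Kim2025RefinedTNC, Thm 1.2] [cite: Kim2022StructureSelmer, Thm. 1.9 (6), Lemma 3.3, Thm. 3.13]
[cite: Sakamoto2024, Thm. 4.4 (p. 926)] [cite: MazurRubin2004, Thm. 5.2.12] [cite: Kato2004Asterisque, Thm. 9.7 (p. 189)] -/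
theorem shallowEqDeep_row_of_fineKatoτ_of_good
    (hS24 : Sakamoto2024.kolyvaginSystems_freeRankOne_zmod_three_pow)
    (hS24₂ : Sakamoto2024.kolyvaginSystems_idealOfBasis_eq_fittingIdeal_zmod_three_pow)
    (hGZK : rank_eq_analyticRank_of_analyticRank_le_one) (hPT : poitouTate_selmerStructure_duality ℚ)
    (htower : ∀ m : ℕ, W.HasSurjectiveModNGaloisRep (3 ^ m : ℕ))
    (ht : Nat.card {Q : (W.baseChange ℚ_[3]).toAffine.Point // (3 : ℕ) • Q = 0} = 1)
    {N : ℕ} [NeZero N] (D : ModularParametrizationData W N) (hN : N = W.conductorNorm ℤ)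
    (hint : ∀ r : ℚ, ratPlusSymbol D.f r ≠ 0 → 0 ≤ padicValRat 3 (ratPlusSymbol D.f r))
    (hord : kuriharaVanishingOrder W 3 D.f = 0)
    (v₃ : HeightOneSpectrum (𝓞 ℚ)) (hv₃ : ((3 : ℕ) : 𝓞 ℚ) ∈ v₃.asIdeal)
    (η : (q : HeightOneSpectrum (𝓞 ℚ)) → (ZMod (Ideal.absNorm q.asIdeal))ˣ)
    (hη : ∀ q : HeightOneSpectrum (𝓞 ℚ), Subgroup.zpowers (η q) = ⊤)
    {t₃ : ℤ} (ht₃ : cuspCoeff D.f 3 = t₃) (hN3 : ¬ 3 ∣ N)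
    (hC1 : ∀ [ContinuousSMul ℤ_[3] (W.tateModule 3)] [Module.Free ℤ_[3] (W.tateModule 3)]
      [Module.Finite ℤ_[3] (W.tateModule 3)],
      ∃ (ι : (n : ℕ) → (CyclotomicField n ℚ →+* ℂ)) (κK : ℝ)
        (Λ : ∀ (k' : ℕ) (r : Finset (HeightOneSpectrum (𝓞 ℚ))),
          H1 (tateRep W 3) (cycSubgroup 3 k' r) →ₗ[ℤ_[3]]
            ℚ_[3] ⊗[ℚ] CyclotomicField (cycLevel 3 k' r) ℚ)
        (Λfin : ∀ j : ℕ, galoisCohomology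
          ((W.torsionGaloisModule (((3 : ℕ) : ℤ) ^ j * ((3 : ℕ) : ℤ))).toLocal (Sum.inr v₃)) 1 →+
            ZMod (3 ^ (j + 1))),
        κK ≠ 0 ∧ (∃ u : ℚ, (u : ℝ) = κK ∧ padicValRat 3 u = 0) ∧
        (∀ j : ℕ, (∀ c : ZMod (3 ^ (j + 1)), ∃ x ∈ propagatedSelmerStructure W 3 j (Sum.inr v₃), Λfin j x = c) ∧
          (∀ x ∈ propagatedSelmerStructure W 3 j (Sum.inr v₃),
            Λfin j x = 0 ↔ x ∈ W.kummerSelmerStructure (((3 : ℕ) : ℤ) ^ j * ((3 : ℕ) : ℤ)) (Sum.inr v₃))) ∧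
            (∀ (j : ℕ) (r : Finset (HeightOneSpectrum (𝓞 ℚ))) (w : (ZMod (cycLevel 3 0 r))ˣ),
          (w : ZMod (cycLevel 3 0 r)) * ((3 : ℕ) : ZMod (cycLevel 3 0 r)) = 1 →
          ∀ (Ψ : H1 (tateRep W 3) (cycSubgroup 3 0 r) →+
              continuousCohomology 1
                (subgroupRep (W.torsionGaloisModule (((3 : ℕ) : ℤ) ^ j * ((3 : ℕ) : ℤ))).toTopRep (cycSubgroup 3 0 r))),
            (∀ (φ : contOneCocycles (subgroupRep (tateRep W 3).toTopRep (cycSubgroup 3 0 r)))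
                (ψ : contOneCocycles
                  (subgroupRep (W.torsionGaloisModule (((3 : ℕ) : ℤ) ^ j * ((3 : ℕ) : ℤ))).toTopRep (cycSubgroup 3 0 r))),
                (∀ g, ((ψ.1 g : geomTorsion W (((3 : ℕ) : ℤ) ^ j * ((3 : ℕ) : ℤ))) : geomPoints W) =
                  TateModule.proj 3 (j + 1) (φ.1 g)) →
                Ψ (oneCocycleClass _ φ) = oneCocycleClass _ ψ) →
            ∀ (y : H1 (tateRep W 3) (cycSubgroup 3 0 r))
              (κ₀ : galoisCohomology (W.torsionGaloisModule (((3 : ℕ) : ℤ) ^ j * ((3 : ℕ) : ℤ))) 1) (s : ℤ_[3]),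
              resSubgroup (W.torsionGaloisModule (((3 : ℕ) : ℤ) ^ j * ((3 : ℕ) : ℤ))).toTopRep (cycSubgroup 3 0 r) 1 κ₀ =
                  Ψ y →
              galoisCohomology.localization (W.torsionGaloisModule (((3 : ℕ) : ℤ) ^ j * ((3 : ℕ) : ℤ))) (Sum.inr v₃) 1 κ₀ ∈
                  propagatedSelmerStructure W 3 j (Sum.inr v₃) →
              (∃ l ∈ cycIntLattice 3 (cycLevel 3 0 r),
                  ((3 : ℕ) : ℤ_[3]) • Λ 0 r y -
                      (((s * (((3 : ℕ) : ℤ_[3]) - (t₃ : ℤ_[3]) + 1) : ℤ_[3]) : ℚ_[3]) ⊗ₜ[ℚ]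
                        (1 : CyclotomicField (cycLevel 3 0 r) ℚ)) =
                    ((3 : ℤ_[3]) ^ (j + 1)) • ∑ g : (ZMod (cycLevel 3 0 r))ˣ,
                      ((((((3 : ℕ) : MonoidAlgebra ℤ_[3] (ZMod (cycLevel 3 0 r))ˣ)) -
                          MonoidAlgebra.single w (t₃ : ℤ_[3]) +
                          MonoidAlgebra.single (w ^ 2) (1 : ℤ_[3])).coeff g : ℤ_[3]) : ℚ_[3]) •
                        Algebra.TensorProduct.map (AlgHom.id ℚ ℚ_[3])
                          (sigma (cycLevel 3 0 r) g : CyclotomicField (cycLevel 3 0 r) ℚ →ₐ[ℚ]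
                            CyclotomicField (cycLevel 3 0 r) ℚ) l) →
              Λfin j (galoisCohomology.localization (W.torsionGaloisModule (((3 : ℕ) : ℤ) ^ j * ((3 : ℕ) : ℤ)))
                  (Sum.inr v₃) 1 κ₀) = PadicInt.toZModPow (j + 1) s) ∧

        ∀ (c d a : ℤ) (A : ℕ), 0 < A → Int.gcd c (6 * 3 * A) = 1 → Int.gcd d (6 * 3 * N) = 1 →
          ∃ (z : ∀ (k' : ℕ) (r : (cyclotomicLevelsRat 3 (badPlaces c d A N)).Ideals),
                H1 (tateRep W 3) ((cyclotomicLevelsRat 3 (badPlaces c d A N)).level k' r.1))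
            (x : ∀ (k' : ℕ) (r : (cyclotomicLevelsRat 3 (badPlaces c d A N)).Ideals),
                CyclotomicField (cycLevel 3 k' r.1) ℚ),
            ZetaBody W 3 D.f ι κK Λ c d a A z x) :
    kuriharaPartialDeepInfty W 3 D.f ≤ kuriharaPartialInfty W 3 D.f :=
  KimAtThreeShallowEqDeepPortRows.shallowEqDeep_row_of_portUnlocked hS24 hS24₂ hGZK hPT W htower D 0 hint hord
    v₃ hv₃ η hη
    (portTwoExp_zero_of_fineKatoτ_of_good W D hN (by simpa using htower 1) hv₃ ht ht₃ hN3 hC1 η) hN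

/-- **The LEAF row (`N11.KimAtThreeRankZeroPUB` at the row = Kim's clause (6) at `p = 3`): `∃ d, ∂^{(∞)} = d ∧
∂⁽⁰⁾ = ord₃ #Ш(3) + d` AT a good (ANOMALOUS allowed) `t = 0` TOWER ROW with the datum at the conductor, FROM
PUB + (C1_τ) ALONE** — same displayed inputs as `shallowEqDeep_row_of_fineKatoτ_of_good`; gen 7's
`KimAtThreeShallowEqDeepPortRows.leaf_row_of_portUnlocked` on §2.  Nothing booked; BSD is not proved by this.
[cite: Kim2025RefinedTNC, Thm 1.1] [cite: Kim2022StructureSelmer, Thm. 1.9 (6)]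
[cite: Sakamoto2024, Thm. 4.4 (p. 926)] [cite: MazurRubin2004, Thm. 4.4.1 and Thm. 5.2.12] -/
theorem leaf_row_of_fineKatoτ_of_good
    (hS24 : Sakamoto2024.kolyvaginSystems_freeRankOne_zmod_three_pow)
    (hS24₂ : Sakamoto2024.kolyvaginSystems_idealOfBasis_eq_fittingIdeal_zmod_three_pow)
    (hGZK : rank_eq_analyticRank_of_analyticRank_le_one) (hPT : poitouTate_selmerStructure_duality ℚ)
    (htower : ∀ m : ℕ, W.HasSurjectiveModNGaloisRep (3 ^ m : ℕ))
    (ht : Nat.card {Q : (W.baseChange ℚ_[3]).toAffine.Point // (3 : ℕ) • Q = 0} = 1)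
    {N : ℕ} [NeZero N] (D : ModularParametrizationData W N) (hN : N = W.conductorNorm ℤ)
    (hint : ∀ r : ℚ, ratPlusSymbol D.f r ≠ 0 → 0 ≤ padicValRat 3 (ratPlusSymbol D.f r))
    (hord : kuriharaVanishingOrder W 3 D.f = 0)
    (v₃ : HeightOneSpectrum (𝓞 ℚ)) (hv₃ : ((3 : ℕ) : 𝓞 ℚ) ∈ v₃.asIdeal)
    (η : (q : HeightOneSpectrum (𝓞 ℚ)) → (ZMod (Ideal.absNorm q.asIdeal))ˣ)
    (hη : ∀ q : HeightOneSpectrum (𝓞 ℚ), Subgroup.zpowers (η q) = ⊤)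
    {t₃ : ℤ} (ht₃ : cuspCoeff D.f 3 = t₃) (hN3 : ¬ 3 ∣ N)
    (hC1 : ∀ [ContinuousSMul ℤ_[3] (W.tateModule 3)] [Module.Free ℤ_[3] (W.tateModule 3)]
      [Module.Finite ℤ_[3] (W.tateModule 3)],
      ∃ (ι : (n : ℕ) → (CyclotomicField n ℚ →+* ℂ)) (κK : ℝ)
        (Λ : ∀ (k' : ℕ) (r : Finset (HeightOneSpectrum (𝓞 ℚ))),
          H1 (tateRep W 3) (cycSubgroup 3 k' r) →ₗ[ℤ_[3]]
            ℚ_[3] ⊗[ℚ] CyclotomicField (cycLevel 3 k' r) ℚ)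
        (Λfin : ∀ j : ℕ, galoisCohomology
          ((W.torsionGaloisModule (((3 : ℕ) : ℤ) ^ j * ((3 : ℕ) : ℤ))).toLocal (Sum.inr v₃)) 1 →+
            ZMod (3 ^ (j + 1))),
        κK ≠ 0 ∧ (∃ u : ℚ, (u : ℝ) = κK ∧ padicValRat 3 u = 0) ∧
        (∀ j : ℕ, (∀ c : ZMod (3 ^ (j + 1)), ∃ x ∈ propagatedSelmerStructure W 3 j (Sum.inr v₃), Λfin j x = c) ∧
          (∀ x ∈ propagatedSelmerStructure W 3 j (Sum.inr v₃),
            Λfin j x = 0 ↔ x ∈ W.kummerSelmerStructure (((3 : ℕ) : ℤ) ^ j * ((3 : ℕ) : ℤ)) (Sum.inr v₃))) ∧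
            (∀ (j : ℕ) (r : Finset (HeightOneSpectrum (𝓞 ℚ))) (w : (ZMod (cycLevel 3 0 r))ˣ),
          (w : ZMod (cycLevel 3 0 r)) * ((3 : ℕ) : ZMod (cycLevel 3 0 r)) = 1 →
          ∀ (Ψ : H1 (tateRep W 3) (cycSubgroup 3 0 r) →+
              continuousCohomology 1
                (subgroupRep (W.torsionGaloisModule (((3 : ℕ) : ℤ) ^ j * ((3 : ℕ) : ℤ))).toTopRep (cycSubgroup 3 0 r))),
            (∀ (φ : contOneCocycles (subgroupRep (tateRep W 3).toTopRep (cycSubgroup 3 0 r)))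
                (ψ : contOneCocycles
                  (subgroupRep (W.torsionGaloisModule (((3 : ℕ) : ℤ) ^ j * ((3 : ℕ) : ℤ))).toTopRep (cycSubgroup 3 0 r))),
                (∀ g, ((ψ.1 g : geomTorsion W (((3 : ℕ) : ℤ) ^ j * ((3 : ℕ) : ℤ))) : geomPoints W) =
                  TateModule.proj 3 (j + 1) (φ.1 g)) →
                Ψ (oneCocycleClass _ φ) = oneCocycleClass _ ψ) →
            ∀ (y : H1 (tateRep W 3) (cycSubgroup 3 0 r))
              (κ₀ : galoisCohomology (W.torsionGaloisModule (((3 : ℕ) : ℤ) ^ j * ((3 : ℕ) : ℤ))) 1) (s : ℤ_[3]),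
              resSubgroup (W.torsionGaloisModule (((3 : ℕ) : ℤ) ^ j * ((3 : ℕ) : ℤ))).toTopRep (cycSubgroup 3 0 r) 1 κ₀ =
                  Ψ y →
              galoisCohomology.localization (W.torsionGaloisModule (((3 : ℕ) : ℤ) ^ j * ((3 : ℕ) : ℤ))) (Sum.inr v₃) 1 κ₀ ∈
                  propagatedSelmerStructure W 3 j (Sum.inr v₃) →
              (∃ l ∈ cycIntLattice 3 (cycLevel 3 0 r),
                  ((3 : ℕ) : ℤ_[3]) • Λ 0 r y -
                      (((s * (((3 : ℕ) : ℤ_[3]) - (t₃ : ℤ_[3]) + 1) : ℤ_[3]) : ℚ_[3]) ⊗ₜ[ℚ]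
                        (1 : CyclotomicField (cycLevel 3 0 r) ℚ)) =
                    ((3 : ℤ_[3]) ^ (j + 1)) • ∑ g : (ZMod (cycLevel 3 0 r))ˣ,
                      ((((((3 : ℕ) : MonoidAlgebra ℤ_[3] (ZMod (cycLevel 3 0 r))ˣ)) -
                          MonoidAlgebra.single w (t₃ : ℤ_[3]) +
                          MonoidAlgebra.single (w ^ 2) (1 : ℤ_[3])).coeff g : ℤ_[3]) : ℚ_[3]) •
                        Algebra.TensorProduct.map (AlgHom.id ℚ ℚ_[3])
                          (sigma (cycLevel 3 0 r) g : CyclotomicField (cycLevel 3 0 r) ℚ →ₐ[ℚ]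
                            CyclotomicField (cycLevel 3 0 r) ℚ) l) →
              Λfin j (galoisCohomology.localization (W.torsionGaloisModule (((3 : ℕ) : ℤ) ^ j * ((3 : ℕ) : ℤ)))
                  (Sum.inr v₃) 1 κ₀) = PadicInt.toZModPow (j + 1) s) ∧

        ∀ (c d a : ℤ) (A : ℕ), 0 < A → Int.gcd c (6 * 3 * A) = 1 → Int.gcd d (6 * 3 * N) = 1 →
          ∃ (z : ∀ (k' : ℕ) (r : (cyclotomicLevelsRat 3 (badPlaces c d A N)).Ideals),
                H1 (tateRep W 3) ((cyclotomicLevelsRat 3 (badPlaces c d A N)).level k' r.1))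
            (x : ∀ (k' : ℕ) (r : (cyclotomicLevelsRat 3 (badPlaces c d A N)).Ideals),
                CyclotomicField (cycLevel 3 k' r.1) ℚ),
            ZetaBody W 3 D.f ι κK Λ c d a A z x) :
    ∃ dd : ℕ, kuriharaPartialInfty W 3 D.f = dd ∧
      kuriharaPartial W 3 D.f 0 =
        ((padicValNat 3 (Nat.card (AddCommGroup.primaryComponent W.sha 3)) + dd : ℕ) : ℕ∞) :=
  KimAtThreeShallowEqDeepPortRows.leaf_row_of_portUnlocked hS24 hS24₂ hGZK hPT W htower D 0 hint hord
    v₃ hv₃ η hη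
    (portTwoExp_zero_of_fineKatoτ_of_good W D hN (by simpa using htower 1) hv₃ ht ht₃ hN3 hC1 η) hN

/-- **The LOWER row — the conclusion of cruxes 19679 `DeepLowerAtThreeOffKatoStratum` / 19075 `DeepLowerAtThree`:
`∃ d, ∂^{(∞)}_deep = d ∧ ∂⁽⁰⁾ ≤ ord₃ #Ш(3) + d` — AT a good (ANOMALOUS allowed) `t = 0` TOWER ROW with the datum at
the conductor, FROM PUB + (C1_τ) ALONE** (for the 19679 owner: no named IMC fact, no Vatsal congruence, no K1 leaf on
these rows) — same displayed inputs as `shallowEqDeep_row_of_fineKatoτ_of_good`; gen 7's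
`KimAtThreeShallowEqDeepPortRows.lower_row_of_portUnlocked` on §2.  Nothing booked; BSD is not proved by this.
[cite: Kim2022StructureSelmer, Thm. 1.9 (6), §1.5.1] [cite: MazurRubin2004, Def. 5.2.11, Thm. 5.2.12 (i)]
[cite: Sakamoto2024, Thm. 4.4 (p. 926)] -/
theorem lower_row_of_fineKatoτ_of_good
    (hS24 : Sakamoto2024.kolyvaginSystems_freeRankOne_zmod_three_pow)
    (hS24₂ : Sakamoto2024.kolyvaginSystems_idealOfBasis_eq_fittingIdeal_zmod_three_pow)
    (hGZK : rank_eq_analyticRank_of_analyticRank_le_one) (hPT : poitouTate_selmerStructure_duality ℚ)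
    (htower : ∀ m : ℕ, W.HasSurjectiveModNGaloisRep (3 ^ m : ℕ))
    (ht : Nat.card {Q : (W.baseChange ℚ_[3]).toAffine.Point // (3 : ℕ) • Q = 0} = 1)
    {N : ℕ} [NeZero N] (D : ModularParametrizationData W N) (hN : N = W.conductorNorm ℤ)
    (hint : ∀ r : ℚ, ratPlusSymbol D.f r ≠ 0 → 0 ≤ padicValRat 3 (ratPlusSymbol D.f r))
    (hord : kuriharaVanishingOrder W 3 D.f = 0)
    (v₃ : HeightOneSpectrum (𝓞 ℚ)) (hv₃ : ((3 : ℕ) : 𝓞 ℚ) ∈ v₃.asIdeal)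
    (η : (q : HeightOneSpectrum (𝓞 ℚ)) → (ZMod (Ideal.absNorm q.asIdeal))ˣ)
    (hη : ∀ q : HeightOneSpectrum (𝓞 ℚ), Subgroup.zpowers (η q) = ⊤)
    {t₃ : ℤ} (ht₃ : cuspCoeff D.f 3 = t₃) (hN3 : ¬ 3 ∣ N)
    (hC1 : ∀ [ContinuousSMul ℤ_[3] (W.tateModule 3)] [Module.Free ℤ_[3] (W.tateModule 3)]
      [Module.Finite ℤ_[3] (W.tateModule 3)],
      ∃ (ι : (n : ℕ) → (CyclotomicField n ℚ →+* ℂ)) (κK : ℝ)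
        (Λ : ∀ (k' : ℕ) (r : Finset (HeightOneSpectrum (𝓞 ℚ))),
          H1 (tateRep W 3) (cycSubgroup 3 k' r) →ₗ[ℤ_[3]]
            ℚ_[3] ⊗[ℚ] CyclotomicField (cycLevel 3 k' r) ℚ)
        (Λfin : ∀ j : ℕ, galoisCohomology
          ((W.torsionGaloisModule (((3 : ℕ) : ℤ) ^ j * ((3 : ℕ) : ℤ))).toLocal (Sum.inr v₃)) 1 →+
            ZMod (3 ^ (j + 1))),
        κK ≠ 0 ∧ (∃ u : ℚ, (u : ℝ) = κK ∧ padicValRat 3 u = 0) ∧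
        (∀ j : ℕ, (∀ c : ZMod (3 ^ (j + 1)), ∃ x ∈ propagatedSelmerStructure W 3 j (Sum.inr v₃), Λfin j x = c) ∧
          (∀ x ∈ propagatedSelmerStructure W 3 j (Sum.inr v₃),
            Λfin j x = 0 ↔ x ∈ W.kummerSelmerStructure (((3 : ℕ) : ℤ) ^ j * ((3 : ℕ) : ℤ)) (Sum.inr v₃))) ∧
            (∀ (j : ℕ) (r : Finset (HeightOneSpectrum (𝓞 ℚ))) (w : (ZMod (cycLevel 3 0 r))ˣ),
          (w : ZMod (cycLevel 3 0 r)) * ((3 : ℕ) : ZMod (cycLevel 3 0 r)) = 1 →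
          ∀ (Ψ : H1 (tateRep W 3) (cycSubgroup 3 0 r) →+
              continuousCohomology 1
                (subgroupRep (W.torsionGaloisModule (((3 : ℕ) : ℤ) ^ j * ((3 : ℕ) : ℤ))).toTopRep (cycSubgroup 3 0 r))),
            (∀ (φ : contOneCocycles (subgroupRep (tateRep W 3).toTopRep (cycSubgroup 3 0 r)))
                (ψ : contOneCocycles
                  (subgroupRep (W.torsionGaloisModule (((3 : ℕ) : ℤ) ^ j * ((3 : ℕ) : ℤ))).toTopRep (cycSubgroup 3 0 r))),
                (∀ g, ((ψ.1 g : geomTorsion W (((3 : ℕ) : ℤ) ^ j * ((3 : ℕ) : ℤ))) : geomPoints W) =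
                  TateModule.proj 3 (j + 1) (φ.1 g)) →
                Ψ (oneCocycleClass _ φ) = oneCocycleClass _ ψ) →
            ∀ (y : H1 (tateRep W 3) (cycSubgroup 3 0 r))
              (κ₀ : galoisCohomology (W.torsionGaloisModule (((3 : ℕ) : ℤ) ^ j * ((3 : ℕ) : ℤ))) 1) (s : ℤ_[3]),
              resSubgroup (W.torsionGaloisModule (((3 : ℕ) : ℤ) ^ j * ((3 : ℕ) : ℤ))).toTopRep (cycSubgroup 3 0 r) 1 κ₀ =
                  Ψ y →
              galoisCohomology.localization (W.torsionGaloisModule (((3 : ℕ) : ℤ) ^ j * ((3 : ℕ) : ℤ))) (Sum.inr v₃) 1 κ₀ ∈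
                  propagatedSelmerStructure W 3 j (Sum.inr v₃) →
              (∃ l ∈ cycIntLattice 3 (cycLevel 3 0 r),
                  ((3 : ℕ) : ℤ_[3]) • Λ 0 r y -
                      (((s * (((3 : ℕ) : ℤ_[3]) - (t₃ : ℤ_[3]) + 1) : ℤ_[3]) : ℚ_[3]) ⊗ₜ[ℚ]
                        (1 : CyclotomicField (cycLevel 3 0 r) ℚ)) =
                    ((3 : ℤ_[3]) ^ (j + 1)) • ∑ g : (ZMod (cycLevel 3 0 r))ˣ,
                      ((((((3 : ℕ) : MonoidAlgebra ℤ_[3] (ZMod (cycLevel 3 0 r))ˣ)) -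
                          MonoidAlgebra.single w (t₃ : ℤ_[3]) +
                          MonoidAlgebra.single (w ^ 2) (1 : ℤ_[3])).coeff g : ℤ_[3]) : ℚ_[3]) •
                        Algebra.TensorProduct.map (AlgHom.id ℚ ℚ_[3])
                          (sigma (cycLevel 3 0 r) g : CyclotomicField (cycLevel 3 0 r) ℚ →ₐ[ℚ]
                            CyclotomicField (cycLevel 3 0 r) ℚ) l) →
              Λfin j (galoisCohomology.localization (W.torsionGaloisModule (((3 : ℕ) : ℤ) ^ j * ((3 : ℕ) : ℤ)))
                  (Sum.inr v₃) 1 κ₀) = PadicInt.toZModPow (j + 1) s) ∧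

        ∀ (c d a : ℤ) (A : ℕ), 0 < A → Int.gcd c (6 * 3 * A) = 1 → Int.gcd d (6 * 3 * N) = 1 →
          ∃ (z : ∀ (k' : ℕ) (r : (cyclotomicLevelsRat 3 (badPlaces c d A N)).Ideals),
                H1 (tateRep W 3) ((cyclotomicLevelsRat 3 (badPlaces c d A N)).level k' r.1))
            (x : ∀ (k' : ℕ) (r : (cyclotomicLevelsRat 3 (badPlaces c d A N)).Ideals),
                CyclotomicField (cycLevel 3 k' r.1) ℚ),
            ZetaBody W 3 D.f ι κK Λ c d a A z x) :
    ∃ dd : ℕ, kuriharaPartialDeepInfty W 3 D.f = dd ∧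
      kuriharaPartial W 3 D.f 0 ≤
        ((padicValNat 3 (Nat.card (AddCommGroup.primaryComponent W.sha 3)) + dd : ℕ) : ℕ∞) :=
  KimAtThreeShallowEqDeepPortRows.lower_row_of_portUnlocked hS24 hS24₂ hGZK hPT W htower D 0 hint hord
    v₃ hv₃ η hη
    (portTwoExp_zero_of_fineKatoτ_of_good W D hN (by simpa using htower 1) hv₃ ht ht₃ hN3 hC1 η) hN

end Rows

end Summit.BirchSwinnertonDyer.BirchSwinnertonDyer.Theorems.KimAtThreeShallowEqDeepAnomalousRows

end
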